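import Mathlib
import Literature.Computability.Complexity.RangeAvoidance
import Literature.Computability.Complexity.SignDegreeXor
import Summits.PneNP.PneNP.Theorems.IP3ExpandingModel
import Summits.PneNP.PneNP.Theorems.IP3Expanding154Count
import Summits.PneNP.PneNP.Theorems.IP3OverlapCount
import Summits.PneNP.PneNP.Theorems.IP3Expanding154Exist
import Summits.PneNP.PneNP.Theorems.PstarSubInstance
import Summits.PneNP.PneNP.Theorems.PstarIP3Law
import Summits.PneNP.PneNP.Theorems.PstarSA2Blind
import Summits.PneNP.PneNP.Theorems.PairwiseSASDPLinear

/-!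
# Random pure `IP₃` instances at ratio `15/4`, IV: simple overlaps by alteration; COR-A with the SDP layer at `k = 6` (w23e)

FRONTIER range-avoidance ladder, rung F-N3 context (restricted-model lower bound for the mixed Sherali–Adams + SDP hierarchy —
nothing here bears on `P` vs `NP`).

From `IP3Expanding154Exist.exists_good154` (an outcome with `m = (C+2)·N` outputs that is `(N/(5L⁸), 15/4)`-boundary expanding
and has at most `69120(C+2)²` output pairs sharing two variables) delete the larger member of every such pair
(`PstarSubInstance.restrictTo`; boundary expansion is `J`-local and survives, `boundaryExpandingQ_restrictTo`; the kept outputs have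
simple overlaps, `simpleOverlap_restrictTo`): `expandingSOIP3Exist` — at every linear stretch `C`, pure-`IP₃` instances with
`n < m`, `C·n ≤ m`, injective slots, SIMPLE OVERLAPS and `(n/c, 15/4)`-boundary expansion, `c = 5·(933120(C+2))⁸`.  With the pairwise
SA+SDP hub `PairwiseSA.pairwiseSASDPLinearLevel` at `k = 6`, `a/b = 15/4` (gate `(3k−7)b = 44 < 45 = 3a`) and the `IP₃` laws
`PstarIP3Law.ip3PairwiseLaws`, this gives the `k = 6` corollary `ip3SASDPLinearBlind`: pure-`IP₃` range avoidance is blind for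
linear-level Sherali–Adams TOGETHER WITH the PSD degree-2 moment matrix, at every constant stretch (the ROUND-23 residue w23e of
COR-A `IP3SALinearBlind`).
-/

set_option linter.dupNamespace false

open Finset Literature.Computability.Complexity
open Summit.PneNP.PneNP.Theorems.PstarSALevel (varSet SimpleOverlap)
open Summit.PneNP.PneNP.Theorems.PstarSASDPLevel (BoundaryExpandingQ SASDPFeasible)
open Summit.PneNP.PneNP.Theorems.IP3ExpandingModel
open Summit.PneNP.PneNP.Theorems.IP3Expanding154Count (bad154 boundaryExpandingQ154_of_not_bad)
open Summit.PneNP.PneNP.Theorems.IP3OverlapCount (ovl6)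
open Summit.PneNP.PneNP.Theorems.IP3Expanding154Exist (exists_good154)
open Summit.PneNP.PneNP.Theorems.PstarSubInstance

namespace Summit.PneNP.PneNP.Theorems.IP3Expanding154Supply

variable {N m : ℕ}

/-! ## The alteration -/

/-- The outputs to delete: the larger member of every output pair sharing two variables. -/
noncomputable def delSet (ω : Outcome6 N m) : Finset (Fin m) := (ovl6 ω).image Prod.snd

/-- At most one deletion per offending pair. -/
theorem card_delSet_le (ω : Outcome6 N m) : (delSet ω).card ≤ (ovl6 ω).card := card_image_le

/-- The kept outputs pairwise share at most one variable. -/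
theorem pairwise_keep (ω : Outcome6 N m) :
    ∀ j ∈ univ \ delSet ω, ∀ j' ∈ univ \ delSet ω, j ≠ j' → (varSet (inst6 ω) j ∩ varSet (inst6 ω) j').card ≤ 1 :=
  pairwise_of_sdiff fun j j' hlt h2 =>
    mem_image.2 ⟨(j, j'), by unfold IP3OverlapCount.ovl6; exact mem_filter.2 ⟨mem_univ _, hlt, h2⟩, rfl⟩

/-- **The altered instance**: keep the outputs outside `delSet ω`. -/
noncomputable def alter (ω : Outcome6 N m) : LocalMap 6 N (univ \ delSet ω).card := restrictTo (inst6 ω) (univ \ delSet ω)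

/-- The altered instance of a good outcome: pure `IP₃` (hence injective slots), `(r, 15/4)`-expanding, simple overlaps. -/
theorem alter_props (ω : Outcome6 N m) {r : ℕ} (hgood : ¬bad154 r ω) :
    (alter ω).IsPure (ipPred 3) ∧ BoundaryExpandingQ 15 4 r (alter ω) ∧ SimpleOverlap (alter ω) :=
  ⟨isPure_restrictTo (isPure_inst6 ω) _, boundaryExpandingQ_restrictTo (boundaryExpandingQ154_of_not_bad r ω hgood) _,
    simpleOverlap_restrictTo (pairwise_keep ω)⟩

/-- The altered instance keeps at least `m − #ovl6 ω` outputs. -/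
theorem le_card_keep (ω : Outcome6 N m) : m - (ovl6 ω).card ≤ (univ \ delSet ω).card := by
  rw [card_univ_sdiff]
  have := card_delSet_le ω
  omega

/-! ## The supply theorem -/

/-- **Expanding pure-`IP₃` instances with simple overlaps at ratio `15/4`, at every linear stretch** (`c = 5·(933120(C+2))⁸`). -/
theorem expandingSOIP3Exist : ∀ C : ℕ, ∃ c : ℕ, 0 < c ∧ ∀ N₀ : ℕ, ∃ n, N₀ ≤ n ∧ ∃ m, n < m ∧ C * n ≤ m ∧
    ∃ I : LocalMap 6 n m, I.IsPure (ipPred 3) ∧ BoundaryExpandingQ 15 4 (n / c) I ∧ SimpleOverlap I := by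
  intro C
  set K := C + 2 with hK
  set L := 933120 * K with hLdef
  have hL1 : 1 ≤ L := by omega
  refine ⟨5 * L ^ 8, by positivity, fun N₀ => ?_⟩
  set N := max (max N₀ 10) (69120 * K ^ 2 + 1) with hNdef
  have hN10 : 10 ≤ N := (le_max_right _ _).trans (le_max_left _ _)
  have hN0 : N₀ ≤ N := (le_max_left _ _).trans (le_max_left _ _)
  have hNK : 69120 * K ^ 2 + 1 ≤ N := le_max_right _ _
  obtain ⟨ω, hgood, hovl⟩ := exists_good154 K L N (K * N) le_rfl hL1 hN10 le_rfl
  have hkeep := le_card_keep ω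
  set m' := (univ \ delSet ω).card with hm'
  have hbig : N < m' ∧ C * N ≤ m' := by
    have e1 : K * N = C * N + 2 * N := by rw [hK]; ring
    set Q := C * N with hQ
    set K2 := K ^ 2 with hK2
    set o := (ovl6 ω).card with ho
    constructor <;> omega
  obtain ⟨hP, hB, hS⟩ := alter_props ω hgood
  exact ⟨N, hN0, m', hbig.1, hbig.2, alter ω, hP, hB, hS⟩

/-! ## COR-A with the SDP layer at `k = 6` -/

/-- **COR-A + SDP₂ (the `k = 6` corollary).**  Pure-`IP₃` range avoidance is blind for linear-level Sherali–Adams together with the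
PSD degree-2 moment matrix at every constant stretch: for every `C` there is `c > 0` such that for infinitely many `n` some pure-`IP₃`
`6`-local map with `C·n ≤ m` outputs has a point outside its range while `SASDPFeasible (n / c)` holds for EVERY target. -/
def IP3SASDPLinearBlind : Prop :=
  ∀ C : ℕ, ∃ c : ℕ, 0 < c ∧ ∀ N : ℕ, ∃ n, N ≤ n ∧ ∃ m, C * n ≤ m ∧
    ∃ I : LocalMap 6 n m, I.IsPure (ipPred 3) ∧ (∃ y, y ∉ I.range) ∧ ∀ y, SASDPFeasible (n / c) I y

/-- **COR-A + SDP₂ holds** (hub `PairwiseSA.pairwiseSASDPLinearLevel` at `k = 6`, `a/b = 15/4`: gate `44 < 45`; laws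
`PstarIP3Law.ip3PairwiseLaws`; supply `expandingSOIP3Exist`).  Restricted-model theorem of the range-avoidance ladder; it says nothing
about `P` versus `NP`. -/
theorem ip3SASDPLinearBlind : IP3SASDPLinearBlind := by
  obtain ⟨c₁, hc₁, H⟩ := PairwiseSA.pairwiseSASDPLinearLevel 6 15 4 (by norm_num) (by norm_num)
  intro C
  obtain ⟨c₀, hc₀, hE⟩ := expandingSOIP3Exist C
  refine ⟨c₀ * c₁, Nat.mul_pos hc₀ hc₁, fun N₀ => ?_⟩
  obtain ⟨n, hn, m, hnm, hCm, I, hP, hB, hS⟩ := hE N₀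
  refine ⟨n, hn, m, hCm, I, hP, PstarSA2Blind.exists_not_mem_range I hnm, fun y => ?_⟩
  obtain ⟨p, μ, hL⟩ := PstarIP3Law.ip3PairwiseLaws n m I hP y
  have hinj : ∀ j, Function.Injective (I.vars j) := fun j => hP.2 j
  have h := H n m (n / c₀) I y p μ hinj hL hB hS
  rwa [Nat.div_div_eq_div_mul] at h

end Summit.PneNP.PneNP.Theorems.IP3Expanding154Supply
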